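import Literature.NumberTheory.Automorphic.GL2AdelicWeightVectors
import Literature.NumberTheory.Automorphic.AutomorphicRepsGLShiftRealisation
import Literature.NumberTheory.Automorphic.AutomorphicRepsGLCuspidalUnitaryHolds
import HarnessLib

/-!
# Every cuspidal automorphic representation of `GL₂(𝔸_ℚ)` of weight one has a clean model of
# weight one with `A_G`-invariant forms, the same Satake parameters, and a weight-one vector
(Gelbart 1997, Prop. 2.5 / Remark 2.5.5, read on an arbitrary Borel–Jacquet datum)

Topic `NumberTheory/Automorphic`. The weight-one dictionary `π ↦ f_π` of Gelbart 1997, Prop. 2.5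
(the input `hdesc` of `exists_isNewform1_of_isPiOfArtinRep_of_dictionary`,
`StrongArtinGL2WeightOneDictionary`) is quantified over **all** cuspidal data `π = W / W'` of
`GL₂(𝔸_ℚ)` of weight one (`AutomorphicRepData.IsOfWeightOne`: archimedean Harish-Chandra parameter
`{0, 0}` and central sign `-1`, both modulo `W'`), while the extraction of the weight-one vector
(`GL2AdelicWeightVectors.exists_isWeightVec_one_of_isOfWeightOne`) and the descent `φ ↦ f_φ`
(`NewformAdelisationDescentHolomorphy.adelicDescentCuspForm`) need exact identities, i.e. a datum
with `W' = ⊥`, and boundedness needs `A_G`-invariant forms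
(`AutomorphicRepsGL.cuspidal_bounded_holds`). A stable complement of `W'` need not exist
(`AutomorphicRepsGLLogDetCounterexample`: the hypothesis `IsSubRealisation` of
`AutomorphicRepSubquotientTransfer` can fail); the clean model along `N = (1 - μ)^j` always does
(`AutomorphicRepsGLShiftRealisation`, from `AutomorphicRepsGLCleanModel` and the semisimplicity of
`A_G`-invariant cusp forms, `stable_cuspidal_eq_sSup_irreducible_holds`). This file runs it for
weight one:

* `Rat.lieOfReal_one` — `1 ⊗ 1` is the central `1 ∈ 𝔤𝔩₂(mixedSpace ℚ)`;
  `AutomorphicRepData.IsOfWeightOne.lieDeriv_one_mem_W'` — **`1 · φ ∈ W'` for `φ ∈ W`, `π` of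
  weight one** (`lieDeriv_one_sub_smul_mem` of `GL2AdelicWeightVectors` with `s₁ = s₂ = 0`, moved to
  the datum's Lie derivative by `Rat.lieDeriv_ofArch_lieOfReal_eq`);
* `AutomorphicRepData.IsShiftRealisation.isOfWeightOne` — **weight one transfers to the clean
  model** (the parameter by `IsShiftRealisation.hasArchParameter`, the sign `r(-1_∞) c + c = 0` by
  `rightTranslation_add_eq_zero`); `IsShiftRealisation.mu_eq_zero_of_isOfWeightOne` — its exponent
  is `μ = 0`, so (`apply_center'_mul`) **its forms are `A_G`-invariant**;
* `AutomorphicRepData.IsOfWeightOne.exists_clean` — **for every cuspidal `π` of `GL₂(𝔸_ℚ)` of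
  weight one there is a clean cuspidal `π₀ = C / ⊥` of weight one with `C ≤ W`, `A_G`-invariant and
  bounded forms, and every Satake parameter of `π₀` a Satake parameter of `π`** (unconditional);
* `AutomorphicRepData.IsOfWeightOne.exists_clean_descentInput` — hence **a non-zero `φ ∈ C`, left
  `GL₂(ℚ)`-invariant and bounded on `GL₂(𝔸_ℚ)`, of `SO(2)`-weight one along `ι_𝔸`, killed by the
  lowering operator and by `Z`, whose pull-back `F_φ(g) = φ(ι_𝔸 g)` has `HasArchWeight 1`,
  `IsArchSmooth GL2Real.incl` and `GL2Real.lowering F_φ = 0`**: the hypotheses `hleft`, `hweight`,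
  `hsmooth`, `hlow`, `hbdd` of `adelicDescentCuspForm N 1` (Gelbart's (2.5.4) (i), (iii)–(vii) for
  `k = 1`); the level `hright` (a `K₁(N)`-fixed line, Casselman 1973) and the Hecke eigen-property
  are the remaining local inputs of Gelbart's Prop. 2.5, not treated here;
* `AutomorphicRepData.IsOfWeightOne.exists_cuspForm_of_fixed`, `exists_clean_cuspForm_of_fixed` —
  **granted a non-zero `K₁(N)`-fixed `φ ∈ C`, the weight-one cusp form `f ∈ S₁(Γ₁(N))`**: the
  `K₁(N)`-fixed vectors of `C` form a subspace stable under `ε`, the rotations and `𝔤𝔩₂(ℝ)` (the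
  archimedean and finite factors commute), so the weight-one vector `ψ` may be taken `K₁(N)`-fixed,
  and `f = adelicDescentCuspForm N 1 ψ` is a non-zero cusp form with `φ_f = ψ` — Gelbart's map
  `π ↦ f_π` (Prop. 2.5, converse, `k = 1`) modulo the new vector (Casselman 1973).

Everything is proved; no definition, no named fact.

## References

* S. Gelbart, *Three lectures on the modularity of `ρ̄_{E,3}` and the Langlands reciprocity
  conjecture* (1997), Prop. 2.5 with (2.5.4), Remark 2.5.2, Remark 2.5.5, proof of Prop. 4.2.
  [Gelbart1997]
* A. Borel, H. Jacquet, *Automorphic forms and automorphic representations*, Proc. Sympos. Pure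
  Math. 33 (1979), part 1, §4.6 and 5.7 ("we may assume `π` unitary"). [BorelJacquetCorvallis1979]
* J. R. Getz, H. Hahn, *An Introduction to Automorphic Representations* (2024), Thm. 6.5.1,
  Cor. 9.1.2, Thm. 9.8.1. [GetzHahn2024]
-/

-- Mathlib idiom (Mathlib/Algebra/Lie/OfAssociative.lean); needed to mention Lie subalgebras of matrix algebras
attribute [local instance 100] LieRing.ofAssociativeRing

open scoped MatrixGroups Matrix NumberField NNReal UpperHalfPlane Classical

noncomputable section

open NumberField NumberField.mixedEmbedding NumberField.InfinitePlace IsDedekindDomain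

namespace Literature.NumberTheory.Automorphic

open GL2Real

variable {hcpt : isCompact_glFiniteIntegralLevel 2 ℚ}

/-- `1 ⊗ 1 = 1`: the identity matrix of `𝔤𝔩₂(ℝ)` goes to the central element
`1 ∈ 𝔤𝔩₂(mixedSpace ℚ)` of `AutomorphicRepsGLCleanModel` / `AutomorphicRepsGLShiftRealisation`
under `X ↦ X ⊗ 1` (`Rat.lieOfReal`). [folklore] -/
theorem Rat.lieOfReal_one : Rat.lieOfReal hcpt 1 = (⟨1, trivial⟩ : (AutomorphyDatum.gl 2 ℚ hcpt).arch.lie) :=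
  Subtype.ext (Matrix.map_one _ (map_zero _) (map_one _))

namespace AutomorphicRepData

variable {π π₀ : AutomorphicRepData (AutomorphyDatum.gl 2 ℚ hcpt)}

/-- **`1 ∈ 𝔤` maps `W` into `W'` for `π` of weight one**: `Z = 1` acts on `W / W'` by `s₁ + s₂`
for the Harish-Chandra parameter `{s₁, s₂}` (`lieDeriv_one_sub_smul_mem`), here `0 + 0`. Gelbart
1997, Remark 2.5.2 / 2.5.5 (`φ(g r) = r^{s₁ + s₂} φ(g)`, `s₁ = s₂ = 0`). [cite: Gelbart1997, Remark 2.5.5] -/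
theorem IsOfWeightOne.lieDeriv_one_mem_W' (h : π.IsOfWeightOne) {φ : (AdelicGroupData.gl 2 ℚ).Adelic → ℂ}
    (hφ : φ ∈ π.W) :
    lieDeriv (AutomorphyDatum.gl 2 ℚ hcpt).ofArch (⟨1, trivial⟩ : (AutomorphyDatum.gl 2 ℚ hcpt).arch.lie) φ ∈ π.W' := by
  have h1 := π.lieDeriv_one_sub_smul_mem h.1 hφ
  rw [add_zero, zero_smul, sub_zero, ← Rat.lieDeriv_ofArch_lieOfReal_eq (hcpt := hcpt), Rat.lieOfReal_one] at h1
  exact h1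

variable {μ : ℂ} {j : ℕ} {M : Submodule ℂ ((AdelicGroupData.gl 2 ℚ).Adelic → ℂ)}

/-- **Weight one transfers to the clean model along `N`**: the parameter `{0, 0}` by
`IsShiftRealisation.hasArchParameter`, and the sign condition `r(-1_∞) φ + φ ∈ W'` on `W` becomes
`r(-1_∞) c + c = 0 ∈ W₀' = ⊥` on `C` (`rightTranslation_add_eq_zero`).
[cite: Gelbart1997, Remark 2.5.2] [cite: BorelJacquetCorvallis1979, §4.6] -/
theorem IsShiftRealisation.isOfWeightOne (h : IsShiftRealisation π π₀ μ j M) (hπ : π.IsOfWeightOne) :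
    π₀.IsOfWeightOne := by
  refine ⟨h.hasArchParameter hπ.1, fun c hc => ?_⟩
  have hmem : ((-1 : GL (Fin 2) (mixedSpace ℚ))) ∈ (AutomorphyDatum.gl 2 ℚ hcpt).arch.maximalCompact := by
    refine ⟨Subgroup.mem_top _, ?_⟩
    change (-1 : GL (Fin 2) (mixedSpace ℚ)) ∈ unitarySubgroupGL (mixedSpace ℚ) (Fin 2)
    rw [mem_unitarySubgroupGL_iff]
    simp
  have h0 := h.rightTranslation_add_eq_zero ⟨-1, hmem⟩ (fun x hx => hπ.2 x hx) hc
  rw [h.bot]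
  exact (Submodule.mem_bot ℂ).2 h0

/-- **The exponent of the clean model of a weight-one `π` is `μ = 0`**: `1` acts on `C` by `μ`
(`lieDeriv_one_eq_smul`) and maps `C` into `W₀' = ⊥`, `π₀` being of weight one. [cite: Gelbart1997, Remark 2.5.5] -/
theorem IsShiftRealisation.mu_eq_zero_of_isOfWeightOne (h : IsShiftRealisation π π₀ μ j M)
    (hπ : π.IsOfWeightOne) : μ = 0 := by
  have h₀ := h.isOfWeightOne hπ
  obtain ⟨c, hcW, hc0⟩ := Submodule.exists_mem_ne_zero_of_ne_bot h.W_ne_bot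
  have h1 := h₀.lieDeriv_one_mem_W' hcW
  rw [h.lieDeriv_one_eq_smul hcW, h.bot, Submodule.mem_bot] at h1
  rcases smul_eq_zero.1 h1 with h2 | h2
  · exact h2
  · exact absurd h2 hc0

/-- **The forms of the clean model of a weight-one `π` are `A_G`-invariant.** [cite: BorelJacquetCorvallis1979, 5.7] -/
theorem IsShiftRealisation.apply_center'_mul_of_isOfWeightOne (h : IsShiftRealisation π π₀ μ j M)
    (hπ : π.IsOfWeightOne) {c : (AdelicGroupData.gl 2 ℚ).Adelic → ℂ} (hc : c ∈ π₀.W) :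
    ∀ z ∈ (AdelicGroupData.gl 2 ℚ).center', ∀ g, c (z * g) = c g :=
  h.apply_center'_mul (h.mu_eq_zero_of_isOfWeightOne hπ) hc

/-- **The clean model of a cuspidal representation of `GL₂(𝔸_ℚ)` of weight one.** For every
cuspidal `π = W / W'` of weight one there is a clean cuspidal `π₀ = C / ⊥` of weight one with
`C ≤ W`, whose forms are `A_G`-invariant, hence bounded (`AutomorphicRepsGL.cuspidal_bounded_holds`),
and whose Satake parameters are Satake parameters of `π`. Unconditional
(`stable_cuspidal_eq_sSup_irreducible_holds`). This is the reduction "`π ⊂ L²_0`" with which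
Gelbart's proof of Prop. 2.5 / 4.2 starts, for Borel–Jacquet data.
[cite: Gelbart1997, Prop. 2.5 (sketch of proof)] [cite: BorelJacquetCorvallis1979, §4.6 and 5.7] -/
theorem IsOfWeightOne.exists_clean {π : CuspidalAutomorphicRepData 2 ℚ hcpt} (hπ : π.1.IsOfWeightOne) :
    ∃ π₀ : CuspidalAutomorphicRepData 2 ℚ hcpt, π₀.1.W' = ⊥ ∧ π₀.1.IsOfWeightOne ∧ π₀.1.W ≤ π.1.W ∧
      (∀ φ ∈ π₀.1.W, ∀ z ∈ (AdelicGroupData.gl 2 ℚ).center', ∀ g, φ (z * g) = φ g) ∧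
      (∀ φ ∈ π₀.1.W, ∃ C : ℝ, ∀ g, ‖φ g‖ ≤ C) ∧
      ∀ (v : HeightOneSpectrum (𝓞 ℚ)) (β : Multiset ℂ),
        π₀.1.HasSatakeParamAt v β → π.1.HasSatakeParamAt v β := by
  obtain ⟨π₀, μ, j, M, h⟩ :=
    π.exists_isShiftRealisation_of_sSup_irreducible AutomorphicRepsGL.stable_cuspidal_eq_sSup_irreducible_holds
  exact ⟨π₀, h.bot, h.isOfWeightOne hπ, h.le, fun φ hφ => h.apply_center'_mul_of_isOfWeightOne hπ hφ,
    fun φ hφ => AutomorphicRepsGL.cuspidal_bounded_holds φ (π₀.2 hφ) (h.apply_center'_mul_of_isOfWeightOne hπ hφ),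
    fun v β hβ => h.hasSatakeParamAt hβ⟩

/-- **Gelbart's conditions (2.5.4) (i), (iii)–(vii) for `k = 1` on the clean model.** For every
cuspidal `π` of `GL₂(𝔸_ℚ)` of weight one there are a clean cuspidal `π₀ = C / ⊥` of weight one with
`C ≤ W` and the Satake parameters of `π`, and a non-zero `φ ∈ C` which is left `GL₂(ℚ)`-invariant,
bounded on `GL₂(𝔸_ℚ)`, of `SO(2)`-weight one along `ι_𝔸` and killed by the lowering operator `X`
and by `Z` (`GL2AdelicWeightVectors.exists_isWeightVec_one_of_isOfWeightOne'` on `π₀`), so that its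
pull-back `F_φ(g) = φ(ι_𝔸 g)` to `GL₂(ℝ)` has weight one at infinity (`HasArchWeight 1`), is
archimedean-smooth, and is killed by `GL2Real.lowering` (`GL2WeightVectors`, restriction lemmas)
— the hypotheses `hleft`, `hweight`, `hsmooth`, `hlow`, `hbdd` of `adelicDescentCuspForm N 1`
(with `Rat.ofRealGLA = Rat.ofRealGL 2`, `Rat.ofRealGLA_apply`). The level hypothesis `hright`
(`K₁(N)`-invariance, Casselman's new vector) is not produced here.
[cite: Gelbart1997, (2.5.4) and Remark 2.5.5] -/
theorem IsOfWeightOne.exists_clean_descentInput {π : CuspidalAutomorphicRepData 2 ℚ hcpt}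
    (hπ : π.1.IsOfWeightOne) :
    ∃ π₀ : CuspidalAutomorphicRepData 2 ℚ hcpt, π₀.1.W' = ⊥ ∧ π₀.1.IsOfWeightOne ∧ π₀.1.W ≤ π.1.W ∧
      (∀ (v : HeightOneSpectrum (𝓞 ℚ)) (β : Multiset ℂ),
        π₀.1.HasSatakeParamAt v β → π.1.HasSatakeParamAt v β) ∧
      ∃ φ ∈ π₀.1.W, φ ≠ 0 ∧ IsLeftInvariant (AdelicGroupData.gl 2 ℚ) φ ∧
        (∃ C : ℝ, ∀ g, ‖φ g‖ ≤ C) ∧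
        IsWeightVec Rat.iotaA 1 φ ∧ lowerFun Rat.iotaA φ = 0 ∧ lieDeriv Rat.iotaA (toLie 1) φ = 0 ∧
        IsArchSmooth Rat.iotaA φ ∧
        HasArchWeight 1 (fun g : GL (Fin 2) ℝ => φ (Rat.ofRealGLA g)) ∧
        IsArchSmooth GL2Real.incl (fun g : GL (Fin 2) ℝ => φ (Rat.ofRealGLA g)) ∧
        ∀ x : GL (Fin 2) ℝ, lowering (fun g : GL (Fin 2) ℝ => φ (Rat.ofRealGLA g)) x = 0 := by
  obtain ⟨π₀, hbot, h₀, hle, hAG, hbdd, hsat⟩ := hπ.exists_clean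
  obtain ⟨φ₁, hφ₁W, hφ₁0⟩ := Submodule.exists_mem_ne_zero_of_ne_bot (fun h0 => π₀.1.lt.ne (hbot.trans h0.symm))
  obtain ⟨φ, hφW, hφ0, hw, hL, hZ⟩ := π₀.1.exists_isWeightVec_one_of_isOfWeightOne' hbot h₀ hφ₁W hφ₁0
  have hs : IsArchSmooth Rat.iotaA φ := (π₀.1.isArchSmooth_of_mem_W hφW).iotaA
  have hw1 := hasArchWeight_one_of_isWeightVec hw hs hZ 1
  have hs1 := isArchSmooth_incl_of_inclOf hs 1
  have hl1 := fun x => lowering_eq_zero_of_lowerFun_eq_zero hL 1 x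
  have e : (fun g : GL (Fin 2) ℝ => φ (1 * Rat.ofRealGLA g)) = fun g : GL (Fin 2) ℝ => φ (Rat.ofRealGLA g) :=
    funext fun g => by rw [one_mul]
  rw [e] at hw1 hs1
  simp only [e] at hl1
  exact ⟨π₀, hbot, h₀, hle, hsat, φ, hφW, hφ0, (π₀.1.isAutomorphicForm_of_mem_W hφW).leftInvariant, hbdd φ hφW,
    hw, hL, hZ, hs, hw1, hs1, hl1⟩

/-! ### From a `K₁(N)`-fixed vector of the clean model to a cusp form of weight one and level `Γ₁(N)` -/

/-- **A `K₁(N)`-fixed vector of a clean weight-one `π` yields a weight-one cusp form on `Γ₁(N)`.**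
Let `π = W / ⊥` be an automorphic representation of `GL₂(𝔸_ℚ)` of weight one whose forms are
`A_G`-invariant cusp forms, and let `φ ∈ W ∖ 0` be fixed by `K₁(N)` (`gammaOneFiniteLevel`). The
subspace `W₁ = {ψ ∈ W | ψ is K₁(N)-fixed}` is stable under `r(ι_𝔸 ε)`, `r(ι_𝔸 k_θ)` and `𝔤𝔩₂(ℝ)`
(the archimedean and finite-adelic factors commute, `Rat.ofRealGL_mul_ofFinite_comm`), so
`GL2AdelicWeightVectors.exists_isWeightVec_one_of_isOfWeightOne` gives `ψ ∈ W₁ ∖ 0` of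
`SO(2)`-weight one with `X ψ = 0`, `Z ψ = 0`; its descent `f_ψ = adelicDescentCuspForm N 1 ψ`
(Gelbart's (2.5.4) (i)–(vii): left invariance of automorphic forms, `K₁(N)`-invariance,
`HasArchWeight 1` / smoothness / `lowering = 0` by the restriction lemmas of `GL2WeightVectors`,
boundedness by `cuspidal_bounded_holds`) is a cusp form of weight one on `Γ₁(N)` with
`φ_{f_ψ} = ψ` (`adelicLiftFun_adelicDescentCuspForm`), in particular `f_ψ ≠ 0`. This is the map
`π ↦ f_π` of Gelbart 1997, Prop. 2.5 (converse direction, weight one) granted the new vector; the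
existence of a `K₁(N)`-fixed vector (Casselman 1973) is the hypothesis `hfix`.
[cite: Gelbart1997, Prop. 2.5 (sketch of proof, (2.5.4)) and Remark 2.5.5] -/
theorem IsOfWeightOne.exists_cuspForm_of_fixed (hbot : π.W' = ⊥) (h1 : π.IsOfWeightOne)
    (hcusp : π.W ≤ cuspFormsGL 2 ℚ hcpt)
    (hAG : ∀ φ ∈ π.W, ∀ z ∈ (AdelicGroupData.gl 2 ℚ).center', ∀ g, φ (z * g) = φ g)
    {N : ℕ} [NeZero N] {φ : (AdelicGroupData.gl 2 ℚ).Adelic → ℂ} (hφ : φ ∈ π.W) (hφ0 : φ ≠ 0)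
    (hfix : ∀ u ∈ gammaOneFiniteLevel ℚ (Ideal.span {(N : 𝓞 ℚ)}),
      rightTranslation (AdelicGroupData.gl 2 ℚ) (GLn.ofFinite 2 ℚ u) φ = φ) :
    ∃ ψ ∈ π.W, ψ ≠ 0 ∧
      (∀ u ∈ gammaOneFiniteLevel ℚ (Ideal.span {(N : 𝓞 ℚ)}),
        rightTranslation (AdelicGroupData.gl 2 ℚ) (GLn.ofFinite 2 ℚ u) ψ = ψ) ∧
      IsWeightVec Rat.iotaA 1 ψ ∧ lowerFun Rat.iotaA ψ = 0 ∧ lieDeriv Rat.iotaA (toLie 1) ψ = 0 ∧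
      ∃ f : CuspForm (CongruenceSubgroup.Gamma1 N) 1,
        adelicLiftFun N 1 f = (show GL (Fin 2) (AdeleRing (𝓞 ℚ) ℚ) → ℂ from ψ) ∧ f ≠ 0 := by
  -- the archimedean and finite-adelic factors commute
  have hcomm : ∀ (x : (RealMatrixGroup.gl ℝ (Fin 2)).carrier) (u : GL (Fin 2) (FiniteAdeleRing (𝓞 ℚ) ℚ)),
      Rat.iotaA x * (show (AdelicGroupData.gl 2 ℚ).Adelic from GLn.ofFinite 2 ℚ u) =
        (show (AdelicGroupData.gl 2 ℚ).Adelic from GLn.ofFinite 2 ℚ u) * Rat.iotaA x := fun x u =>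
    Rat.ofRealGL_mul_ofFinite_comm 2 (x : GL (Fin 2) ℝ) u
  -- `W₁ = W ∩ Fix(K₁(N))`
  let W₁ : Submodule ℂ ((AdelicGroupData.gl 2 ℚ).Adelic → ℂ) :=
    { carrier := {ψ | ψ ∈ π.W ∧ ∀ u ∈ gammaOneFiniteLevel ℚ (Ideal.span {(N : 𝓞 ℚ)}),
        rightTranslation (AdelicGroupData.gl 2 ℚ) (GLn.ofFinite 2 ℚ u) ψ = ψ}
      add_mem' := fun {a b} ha hb => ⟨add_mem ha.1 hb.1, fun u hu => by rw [map_add, ha.2 u hu, hb.2 u hu]⟩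
      zero_mem' := ⟨zero_mem _, fun u _ => map_zero _⟩
      smul_mem' := fun c x hx => ⟨Submodule.smul_mem _ c hx.1, fun u hu => by rw [map_smul, hx.2 u hu]⟩ }
  have hW₁mem : ∀ ψ, ψ ∈ W₁ ↔ ψ ∈ π.W ∧ ∀ u ∈ gammaOneFiniteLevel ℚ (Ideal.span {(N : 𝓞 ℚ)}),
      rightTranslation (AdelicGroupData.gl 2 ℚ) (GLn.ofFinite 2 ℚ u) ψ = ψ := fun ψ => Iff.rfl
  have hW₁ : W₁ ≤ π.W := fun ψ hψ => ((hW₁mem ψ).1 hψ).1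
  -- stability of `W₁` under `r(ι_𝔸 k)` for `k ∈ GL₂(ℝ)` with `r(ι_𝔸 k) W ⊆ W`
  have harch : ∀ (x : (RealMatrixGroup.gl ℝ (Fin 2)).carrier) (ψ : (AdelicGroupData.gl 2 ℚ).Adelic → ℂ),
      ψ ∈ W₁ → archTranslate Rat.iotaA x ψ ∈ π.W → archTranslate Rat.iotaA x ψ ∈ W₁ := by
    intro x ψ hψ hmem
    refine (hW₁mem _).2 ⟨hmem, fun u hu => ?_⟩
    funext g
    rw [rightTranslation_apply, archTranslate_apply, archTranslate_apply, mul_assoc, ← hcomm x u, ← mul_assoc]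
    exact congrFun (((hW₁mem ψ).1 hψ).2 u hu) (g * Rat.iotaA x)
  have heps : ∀ ψ ∈ W₁, archTranslate Rat.iotaA epsK ψ ∈ W₁ := fun ψ hψ =>
    harch epsK ψ hψ (π.archTranslate_iotaA_epsK_mem (hW₁ hψ))
  have hrot : ∀ θ : ℝ, ∀ ψ ∈ W₁, archTranslate Rat.iotaA (rotK θ) ψ ∈ W₁ := fun θ ψ hψ =>
    harch (rotK θ) ψ hψ (π.archTranslate_iotaA_rotK_mem (hW₁ hψ) θ)
  have hlie : ∀ (X : Matrix (Fin 2) (Fin 2) ℝ), ∀ ψ ∈ W₁, lieDeriv Rat.iotaA (toLie X) ψ ∈ W₁ := by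
    intro X ψ hψ
    refine (hW₁mem _).2 ⟨π.lieDeriv_iotaA_mem (hW₁ hψ) X, fun u hu => ?_⟩
    have hfixψ := ((hW₁mem ψ).1 hψ).2 u hu
    have e : rightTranslation (AdelicGroupData.gl 2 ℚ) (GLn.ofFinite 2 ℚ u) (lieDeriv Rat.iotaA (toLie X) ψ) =
        fun g => lieDeriv Rat.iotaA (toLie X) ψ (g * (show (AdelicGroupData.gl 2 ℚ).Adelic from GLn.ofFinite 2 ℚ u)) := rfl
    have e' : (fun g => ψ (g * (show (AdelicGroupData.gl 2 ℚ).Adelic from GLn.ofFinite 2 ℚ u))) = ψ := hfixψ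
    rw [e, ← lieDeriv_comp_mul_right Rat.iotaA (toLie X) ψ (fun x => hcomm x u), e']
  have hφW₁ : φ ∈ W₁ := (hW₁mem φ).2 ⟨hφ, hfix⟩
  -- the weight-one vector inside `W₁`
  obtain ⟨ψ, hψW₁, hψ0, hw, hL, hZ⟩ := π.exists_isWeightVec_one_of_isOfWeightOne hbot h1 hW₁ heps hrot hlie hφW₁ hφ0
  have hψW : ψ ∈ π.W := hW₁ hψW₁
  have hψfix := ((hW₁mem ψ).1 hψW₁).2
  -- Gelbart's conditions (2.5.4)
  have hs : IsArchSmooth Rat.iotaA ψ := (π.isArchSmooth_of_mem_W hψW).iotaA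
  have hw1 := hasArchWeight_one_of_isWeightVec hw hs hZ 1
  have hs1 := isArchSmooth_incl_of_inclOf hs 1
  have hl1 := fun x => lowering_eq_zero_of_lowerFun_eq_zero hL 1 x
  have e1 : (fun g : GL (Fin 2) ℝ => ψ (1 * Rat.ofRealGLA g)) = fun g : GL (Fin 2) ℝ => ψ (Rat.ofRealGLA g) :=
    funext fun g => by rw [one_mul]
  rw [e1] at hw1 hs1
  simp only [e1] at hl1
  have hleft : ∀ (γ : GL (Fin 2) ℚ) (g : GL (Fin 2) (AdeleRing (𝓞 ℚ) ℚ)),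
      ψ ((show (AdelicGroupData.gl 2 ℚ).Adelic from GLn.ofGlobal 2 ℚ γ * g)) = ψ g := fun γ g =>
    (π.isAutomorphicForm_of_mem_W hψW).leftInvariant (GLn.ofGlobal 2 ℚ γ) ⟨γ, rfl⟩ g
  have hright : ∀ u ∈ gammaOneFiniteLevel ℚ (Ideal.span {(N : 𝓞 ℚ)}), ∀ g : GL (Fin 2) (AdeleRing (𝓞 ℚ) ℚ),
      ψ ((show (AdelicGroupData.gl 2 ℚ).Adelic from g * GLn.ofFinite 2 ℚ u)) = ψ g := fun u hu g =>
    congrFun (hψfix u hu) g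
  obtain ⟨C, hC⟩ := AutomorphicRepsGL.cuspidal_bounded_holds ψ (hcusp hψW) (hAG ψ hψW)
  have hbdd : ∃ C : ℝ, ∀ x : GL (Fin 2) ℝ, 0 < x.det.val → ‖ψ (Rat.ofRealGLA x)‖ ≤ C := ⟨C, fun x _ => hC _⟩
  let f : CuspForm (CongruenceSubgroup.Gamma1 N) 1 :=
    adelicDescentCuspForm N 1 one_pos (show GL (Fin 2) (AdeleRing (𝓞 ℚ) ℚ) → ℂ from ψ) hleft hright hw1 hs1
      (fun x _ => hl1 x) hbdd
  have hf : adelicLiftFun N 1 f = (show GL (Fin 2) (AdeleRing (𝓞 ℚ) ℚ) → ℂ from ψ) :=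
    adelicLiftFun_adelicDescentCuspForm one_pos hleft hright hw1 hs1 (fun x _ => hl1 x) hbdd
  refine ⟨ψ, hψW, hψ0, hψfix, hw, hL, hZ, f, hf, fun hf0 => hψ0 ?_⟩
  -- `f = 0` would force `ψ = φ_f = 0`
  have h0 : adelicLiftFun N 1 ((0 : CuspForm (CongruenceSubgroup.Gamma1 N) 1) : ℍ → ℂ) =
      (show GL (Fin 2) (AdeleRing (𝓞 ℚ) ℚ) → ℂ from ψ) := by rw [← hf0]; exact hf
  funext g
  have hg := congrFun h0 g
  rw [CuspForm.coe_zero, adelicLiftFun, archLift_apply, SlashAction.zero_slash, Pi.zero_apply, zero_mul] at hg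
  exact hg.symm

/-- **The weight-one dictionary `π ↦ f_π` up to the new vector.** For every cuspidal `π` of
`GL₂(𝔸_ℚ)` of weight one there is a clean cuspidal `π₀ = C / ⊥` of weight one with `C ≤ W` and
the Satake parameters of `π`, such that **every non-zero `K₁(N)`-fixed `φ ∈ C` produces a non-zero
cusp form `f ∈ S₁(Γ₁(N))` whose adelic lift `φ_f` is a non-zero `K₁(N)`-fixed weight-one vector of
`C` killed by `X` and `Z`** (`exists_clean` and `exists_cuspForm_of_fixed`). What is left of
Gelbart's Prop. 2.5 (converse, `k = 1`) after this is the local theory: the existence of the new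
vector (Casselman 1973, Thm. 1) and the identification of `f`'s Hecke eigenvalues / level with the
Satake parameters / conductor of `π`. [cite: Gelbart1997, Prop. 2.5 and Remark 2.5.5] -/
theorem IsOfWeightOne.exists_clean_cuspForm_of_fixed {π : CuspidalAutomorphicRepData 2 ℚ hcpt}
    (hπ : π.1.IsOfWeightOne) :
    ∃ π₀ : CuspidalAutomorphicRepData 2 ℚ hcpt, π₀.1.W' = ⊥ ∧ π₀.1.IsOfWeightOne ∧ π₀.1.W ≤ π.1.W ∧
      (∀ (v : HeightOneSpectrum (𝓞 ℚ)) (β : Multiset ℂ),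
        π₀.1.HasSatakeParamAt v β → π.1.HasSatakeParamAt v β) ∧
      ∀ (N : ℕ) [NeZero N] (φ : (AdelicGroupData.gl 2 ℚ).Adelic → ℂ), φ ∈ π₀.1.W → φ ≠ 0 →
        (∀ u ∈ gammaOneFiniteLevel ℚ (Ideal.span {(N : 𝓞 ℚ)}),
          rightTranslation (AdelicGroupData.gl 2 ℚ) (GLn.ofFinite 2 ℚ u) φ = φ) →
        ∃ ψ ∈ π₀.1.W, ψ ≠ 0 ∧
          (∀ u ∈ gammaOneFiniteLevel ℚ (Ideal.span {(N : 𝓞 ℚ)}),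
            rightTranslation (AdelicGroupData.gl 2 ℚ) (GLn.ofFinite 2 ℚ u) ψ = ψ) ∧
          IsWeightVec Rat.iotaA 1 ψ ∧ lowerFun Rat.iotaA ψ = 0 ∧ lieDeriv Rat.iotaA (toLie 1) ψ = 0 ∧
          ∃ f : CuspForm (CongruenceSubgroup.Gamma1 N) 1,
            adelicLiftFun N 1 f = (show GL (Fin 2) (AdeleRing (𝓞 ℚ) ℚ) → ℂ from ψ) ∧ f ≠ 0 := by
  obtain ⟨π₀, hbot, h₀, hle, hAG, -, hsat⟩ := hπ.exists_clean
  exact ⟨π₀, hbot, h₀, hle, hsat, fun N _ φ hφ hφ0 hfix => h₀.exists_cuspForm_of_fixed hbot π₀.2 hAG hφ hφ0 hfix⟩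

end AutomorphicRepData

end Literature.NumberTheory.Automorphic

end
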